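import Summits.HodgeConjecture.HodgeConjecture.Theorems.K2E1bCubicCasimirExtremeVector
import Summits.HodgeConjecture.HodgeConjecture.Theorems.K2E1bTwistIrreducible
import HarnessLib

/-!
# K2 ∕ E1b — LAWS BRICK U8-4c-B (2∕2) «the cubic scalar of a twisted Kovačević datum from one corner vector»

Cell hodgecm-mathlib, Track B «K2-LIT», engine E1b, unit U8 «archimedean packet signs»; crux item h413 = stmt-HodgeConjecture-24833
(supports-only helper; closes nothing by itself).  Part 2 of the default take of K2-defs1 (g3) 2026-09-04T03:04Z («=» GO K2E1b-plan (g3) 03:09Z;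
box-side pre-check K2E1b-r01 (g4) 03:11Z).  Part 1 = ★ `Theorems/K2E1bCubicCasimirExtremeVector.lean` (`upqCubicOp_apply_of_extreme_top∕_bottom`,
`hasCubicScalar_of_eigenvector`, `cubicOf_cast`).  THEOREMS ONLY — no definition, no `sorry`, no axiom, no instance (one
`attribute [local instance] LieRing.ofAssociativeRing`), no notation.  Uses only the GENERIC Kovačević interface (★ `SU21Datum`: `vec`, `S`, `Ha_vec`,
`Hb_vec`, `ρfun_E`, the `𝔭^±`-action lemmas) and the twist predicate ★ `IsTwistOf`; RECORD INTERNALS (which corner of which cell `dsCellDatum j a b c`,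
the central exponent `centralOf a b c`) stay with the calibration brick (iii).

## What is proved

* §3 THE TWIST DICTIONARY for a datum `𝒟` and a central twist `σ` of `𝒟.ρ` by `z` (`σ X = kovLie 𝒟.ρ X + z·tr(X)·1`, ★ `IsTwistOf`):
  `upqLieC σ M = 𝒟.ρ(M̃) + z·tr(M)·1` for every complex `M` (`upqLieC_of_isTwistOf`; `M̃` = `M` reindexed along `Fin 2 ⊕ Fin 1 ≃ Fin 3`), on matrix units
  `upqLieC σ E_ij v = ⁅E_ĩj̃, v⁆ + z δ_ij v` (`upqLieC_single_apply_of_isTwistOf`), and the `σ`-stable subspaces of an IRREDUCIBLE datum are trivial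
  (`submodule_eq_bot_or_top_of_isTwistOf`, via ★ `K2E1bTwistIrreducible.upq_isIrreducibleGK_of_lieModule_isIrreducible_addSmul` with the trivial `K`-action).
* §4 THE ENGINE: for an irreducible datum twisted by `z`, a vector `u ≠ 0` killed by `E₀₁, E₂₀, E₂₁` (resp. `E₀₁, E₀₂, E₁₂`) with `⁅E_ii, u⁆ = μ_i u`
  gives `HasCubicScalar σ (P(μ₂ + z + 1, μ₀ + z, μ₁ + z − 1))` (resp. `P(μ₀ + z + 1, μ₁ + z, μ₂ + z − 1)`) — `hasCubicScalar_of_isTwistOf_bottom ∕ _top`;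
  on Kovačević's basis the corner vector `u¹_{n,m}` of a `K`-type `(n, m) ∈ S` with NO `K`-type at `(n ± 1, m − 3)` (resp. `(n ± 1, m + 3)`) is such a
  vector (`lie_E20∕E21∕E02∕E12_vec_one_of_not_mem`, ★ `lie_E01_vec_one`) with `μ = ((3n+m−3)∕6, (m−3n+3)∕6, −m∕3)` (`lie_E00∕E11∕E22_vec_one`), whence
  **`hasCubicScalar_of_isTwistOf_vec_bottom`**: `C₃ = P(1 − m∕3 + z, (3n+m−3)∕6 + z, (m−3n−3)∕6 + z)·1` and
  **`hasCubicScalar_of_isTwistOf_vec_top`**: `C₃ = P((3n+m+3)∕6 + z, (m−3n+3)∕6 + z, −m∕3 − 1 + z)·1`, and the INTEGER FORMS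
  **`hasCubicScalar_cubicOf_of_isTwistOf_vec_bottom ∕ _top`**: if those three arguments are the integers `a, b, c`, then `HasCubicScalar σ ↑(cubicOf a b c)`.
  The calibration of a record cell with an extreme corner is then: its corner `(n₀, m₀)`, `z = centralOf a b c ∕ 3`, three `ring`∕`push_cast` identities,
  ★ `cubicOf_swap₁₂∕₂₃`, ★ `hasCubicPin_mk_iff`.

REACH (honest, K2E1b-r01 (g4) pre-check 03:11Z): `j = 1` (`D_φ⁺`: bottom corner `(n, m) = (a − b, a + b − 2c + 3)`, `P(c, a, b)`) and `j = 2` (`D_φ⁻`: top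
corner `(b − c, b + c − 2a − 3)`, `P(b, c, a)`) — both `= cubicOf a b c`, 0 mismatches on paper; `j = 0` (`D_φ`) has no Borel-extreme vector for the compact
Cartan and is NOT reached here (propagation of the `C₃`-scalar along the `(+)`-series module = a separate brick).

Sources: [Kovacevic2021] D. Kovačević, Acta Math. Spalatensia 1 (2021) 105–125, §3 Def 1, Thm 1, Thm 3; [Iachello2015] §7.4.1 (7.24); [KnappVogan1995]
Prop. 4.120 (infinitesimal character under a central twist); [BorelWallach2000] 0 §2.5, II §2.3.

HONEST LABEL: HC_CM is proved only modulo the 7 printed citations (2 remaining named inputs: hLiu418 = stmt-HodgeConjecture-24832,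
h413 = stmt-HodgeConjecture-24833) until rung 0 closes; LAWS bricks close nothing by themselves.
-/

set_option autoImplicit false
set_option linter.dupNamespace false

noncomputable section

namespace Summit.HodgeConjecture.HodgeConjecture.Cruxes.H413.K2E1bGKCohomologyU21

open Literature.NumberTheory.Automorphic
open Literature.RepresentationTheory
open Literature.RepresentationTheory.BorelWallach2000
open Literature.RepresentationTheory.KonnoKonno2007 Literature.RepresentationTheory.KonnoKonno2007.RealDualPair
open Literature.RepresentationTheory.KonnoKonno2007.RealDualPair.UForm
open Literature.RepresentationTheory.Kovacevic2021 Literature.RepresentationTheory.Kovacevic2021.SU21Datum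
open Summit.HodgeConjecture.HodgeConjecture.Cruxes.H413.F0P3bLocalAPacketsDefs
open Summit.HodgeConjecture.HodgeConjecture.Cruxes.H413.F0P3bU21Restriction

-- Mathlib idiom (as in `GKModules`, the `Upq*` files, the Kovačević topic): commutator bracket on `Module.End` ∕ matrices
attribute [local instance 100] LieRing.ofAssociativeRing

/-! ## §3 The twist dictionary for a Kovačević datum -/

section Twist

variable (𝒟 : SU21Datum) {z : ℂ} {σ : G21.lie →ₗ⁅ℝ⁆ Module.End ℂ 𝒟.V}

/-- **The complexified action of a central twist**: for `σ X = kovLie 𝒟.ρ X + z·tr(X)·1` (★ `IsTwistOf`),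
`ρ_ℂ(M) = 𝒟.ρ(M̃) + z·tr(M)·1` for EVERY complex matrix `M` (`M̃` = `M` reindexed along `Fin 2 ⊕ Fin 1 ≃ Fin 3`): `ρ_ℂ(M) = σ(A M) + i σ(B M)` (★ `upqLieC_apply`)
and `A M + i B M = M` (★ `coe_upqRePart_add_I_smul_coe_upqImPart`). [cite: KnappVogan1995, Prop. 4.120] -/
theorem upqLieC_of_isTwistOf (hσ : IsTwistOf 𝒟.ρ z σ) (M : Matrix (Fin 2 ⊕ Fin 1) (Fin 2 ⊕ Fin 1) ℂ) :
    upqLieC σ M =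
      𝒟.ρ (Matrix.reindex (finSumFinEquiv : Fin 2 ⊕ Fin 1 ≃ Fin 3) (finSumFinEquiv : Fin 2 ⊕ Fin 1 ≃ Fin 3) M)
        + (z * M.trace) • (1 : Module.End ℂ 𝒟.V) := by
  -- the complex-linear extension `τ` of `σ`
  let τ : Matrix (Fin 2 ⊕ Fin 1) (Fin 2 ⊕ Fin 1) ℂ →ₗ[ℂ] Module.End ℂ 𝒟.V :=
    { toFun := fun N =>
        𝒟.ρ (Matrix.reindex (finSumFinEquiv : Fin 2 ⊕ Fin 1 ≃ Fin 3) (finSumFinEquiv : Fin 2 ⊕ Fin 1 ≃ Fin 3) N) +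
          (z * N.trace) • (1 : Module.End ℂ 𝒟.V)
      map_add' := fun N N' => by
        simp only [Matrix.reindex_apply, Matrix.submatrix_add, Pi.add_apply, map_add, Matrix.trace_add, mul_add, add_smul]
        abel
      map_smul' := fun c N => by
        simp only [Matrix.reindex_apply, Matrix.submatrix_smul, Pi.smul_apply, map_smul, Matrix.trace_smul, smul_eq_mul,
          RingHom.id_apply, smul_add, smul_smul, mul_left_comm c z] }
  have hτ : ∀ N : Matrix (Fin 2 ⊕ Fin 1) (Fin 2 ⊕ Fin 1) ℂ, τ N =
      𝒟.ρ (Matrix.reindex (finSumFinEquiv : Fin 2 ⊕ Fin 1 ≃ Fin 3) (finSumFinEquiv : Fin 2 ⊕ Fin 1 ≃ Fin 3) N) +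
        (z * N.trace) • (1 : Module.End ℂ 𝒟.V) := fun N => rfl
  have hστ : ∀ X : G21.lie, σ X = τ (X : Matrix (Fin 2 ⊕ Fin 1) (Fin 2 ⊕ Fin 1) ℂ) := fun X => by
    rw [hσ X, kovLie_apply, hτ]
  rw [← hτ, upqLieC_apply, hστ, hστ, ← LinearMap.map_smul, ← map_add, coe_upqRePart_add_I_smul_coe_upqImPart]

/-- **On matrix units**: `ρ_ℂ(E_ij) v = ⁅E_ĩj̃, v⁆ + z δ_ij v` (`ĩ = finSumFinEquiv i`). [cite: KnappVogan1995, Prop. 4.120] -/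
theorem upqLieC_single_apply_of_isTwistOf (hσ : IsTwistOf 𝒟.ρ z σ) (i j : Fin 2 ⊕ Fin 1) (v : 𝒟.V) :
    upqLieC σ (Matrix.single i j 1) v =
      ⁅E (finSumFinEquiv i) (finSumFinEquiv j), v⁆ + (if i = j then z else 0) • v := by
  rw [upqLieC_of_isTwistOf 𝒟 hσ, LinearMap.add_apply, LinearMap.smul_apply, Module.End.one_apply, Matrix.reindex_apply,
    Matrix.submatrix_single_equiv, Equiv.symm_symm, lie_def, ρ_apply]
  congr 2
  by_cases h : i = j
  · subst h; rw [if_pos rfl, Matrix.trace_single_eq_same, mul_one]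
  · rw [if_neg h, Matrix.trace_single_eq_of_ne _ _ _ h, mul_zero]

/-- **`σ`-stable subspaces of an irreducible datum are trivial** (the twist is central): ★ K0-with-cocycle
`upq_isIrreducibleGK_of_lieModule_isIrreducible_addSmul` with the TRIVIAL `K`-action (every subspace is `K`-stable for it, so `(𝔤, K)`-irreducibility
there is exactly `𝔤`-irreducibility). [cite: Kovacevic2021, §3 Thm. 3] [cite: KnappVogan1995, §II.4] -/
theorem submodule_eq_bot_or_top_of_isTwistOf [LieModule.IsIrreducible ℂ (Matrix (Fin 3) (Fin 3) ℂ) 𝒟.V] (hσ : IsTwistOf 𝒟.ρ z σ)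
    (W : Submodule ℂ 𝒟.V) (hW : ∀ (X : G21.lie) (w : 𝒟.V), w ∈ W → σ X w ∈ W) : W = ⊥ ∨ W = ⊤ := by
  have hGK : IsIrreducibleGK (1 : Representation ℂ G21.maximalCompact 𝒟.V) σ :=
    K2E1bTwistIrreducible.upq_isIrreducibleGK_of_lieModule_isIrreducible_addSmul (L := Matrix (Fin 3) (Fin 3) ℂ)
      ((Matrix.reindexLinearEquiv ℂ ℂ (finSumFinEquiv : Fin 2 ⊕ Fin 1 ≃ Fin 3) (finSumFinEquiv : Fin 2 ⊕ Fin 1 ≃ Fin 3) :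
        Matrix (Fin 2 ⊕ Fin 1) (Fin 2 ⊕ Fin 1) ℂ ≃ₗ[ℂ] Matrix (Fin 3) (Fin 3) ℂ).toLinearMap)
      (LinearEquiv.surjective _) (z • Matrix.traceLinearMap (Fin 2 ⊕ Fin 1) ℂ ℂ) 1 σ fun X v => by
        rw [hσ X, LinearMap.add_apply, LinearMap.smul_apply, Module.End.one_apply, kovLie_apply, lie_def, ρ_apply,
          LinearMap.smul_apply, Matrix.traceLinearMap_apply, smul_eq_mul]
        rfl
  refine hGK.2 W ⟨fun k w hw => ?_, fun X w hw => hW X w hw⟩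
  rw [MonoidHom.one_apply, Module.End.one_apply]
  exact hw

end Twist

/-! ## §4 The calibration engine: cubic scalar of a twisted irreducible datum from one corner vector -/

section Engine

variable (𝒟 : SU21Datum) {z : ℂ} {σ : G21.lie →ₗ⁅ℝ⁆ Module.End ℂ 𝒟.V}

/-- `Fin 2 ⊕ Fin 1 ≃ Fin 3` on `inl 0`. [folklore] -/
private theorem fsf_inl_zero : (finSumFinEquiv (Sum.inl 0 : Fin 2 ⊕ Fin 1) : Fin 3) = 0 := by decide
/-- `Fin 2 ⊕ Fin 1 ≃ Fin 3` on `inl 1`. [folklore] -/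
private theorem fsf_inl_one : (finSumFinEquiv (Sum.inl 1 : Fin 2 ⊕ Fin 1) : Fin 3) = 1 := by decide
/-- `Fin 2 ⊕ Fin 1 ≃ Fin 3` on `inr 0`. [folklore] -/
private theorem fsf_inr_zero : (finSumFinEquiv (Sum.inr 0 : Fin 2 ⊕ Fin 1) : Fin 3) = 2 := by decide

/-- The twisted matrix units on a vector, index by index (diagonal). [cite: KnappVogan1995, Prop. 4.120] -/
private theorem twist_diag (hσ : IsTwistOf 𝒟.ρ z σ) {u : 𝒟.V} {i : Fin 2 ⊕ Fin 1} {a : Fin 3} (ha : finSumFinEquiv i = a) {μ : ℂ}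
    (h : ⁅E a a, u⁆ = μ • u) : upqLieC σ (Matrix.single i i 1) u = (μ + z) • u := by
  rw [upqLieC_single_apply_of_isTwistOf 𝒟 hσ, ha, h, if_pos rfl, add_smul]

/-- The twisted matrix units on a vector, index by index (off-diagonal annihilator). [cite: KnappVogan1995, Prop. 4.120] -/
private theorem twist_off (hσ : IsTwistOf 𝒟.ρ z σ) {u : 𝒟.V} {i j : Fin 2 ⊕ Fin 1} (hij : i ≠ j) {a b : Fin 3}
    (ha : finSumFinEquiv i = a) (hb : finSumFinEquiv j = b) (h : ⁅E a b, u⁆ = 0) : upqLieC σ (Matrix.single i j 1) u = 0 := by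
  rw [upqLieC_single_apply_of_isTwistOf 𝒟 hσ, ha, hb, h, if_neg hij, zero_smul, add_zero]

/-- **BOTTOM corner ⇒ cubic scalar.**  For an irreducible datum twisted by `z` and `u ≠ 0` with `⁅E₀₁, u⁆ = ⁅E₂₀, u⁆ = ⁅E₂₁, u⁆ = 0`,
`⁅E_ii, u⁆ = μ_i u`: `C₃ = P(μ₂ + z + 1, μ₀ + z, μ₁ + z − 1)·1` on the twisted module. [cite: Iachello2015, (7.24)] [cite: KnappVogan1995, Prop. 4.120] -/
theorem hasCubicScalar_of_isTwistOf_bottom [LieModule.IsIrreducible ℂ (Matrix (Fin 3) (Fin 3) ℂ) 𝒟.V] (hσ : IsTwistOf 𝒟.ρ z σ)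
    {u : 𝒟.V} (hu : u ≠ 0) {μ₀ μ₁ μ₂ : ℂ}
    (h00 : ⁅E 0 0, u⁆ = μ₀ • u) (h11 : ⁅E 1 1, u⁆ = μ₁ • u) (h22 : ⁅E 2 2, u⁆ = μ₂ • u)
    (h01 : ⁅E 0 1, u⁆ = 0) (h20 : ⁅E 2 0, u⁆ = 0) (h21 : ⁅E 2 1, u⁆ = 0) :
    HasCubicScalar σ
      ((μ₂ + z + 1) ^ 3 + (μ₀ + z) ^ 3 + (μ₁ + z - 1) ^ 3
        + ((μ₂ + z + 1) ^ 2 + (μ₀ + z) ^ 2 + (μ₁ + z - 1) ^ 2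
            - (μ₂ + z + 1) * (μ₀ + z) - (μ₀ + z) * (μ₁ + z - 1) - (μ₁ + z - 1) * (μ₂ + z + 1))
        - 2 * ((μ₂ + z + 1) + (μ₀ + z) + (μ₁ + z - 1)) - 3) :=
  hasCubicScalar_of_eigenvector (submodule_eq_bot_or_top_of_isTwistOf 𝒟 hσ) hu
    (upqCubicOp_apply_of_extreme_bottom σ
      (twist_diag 𝒟 hσ fsf_inl_zero h00) (twist_diag 𝒟 hσ fsf_inl_one h11) (twist_diag 𝒟 hσ fsf_inr_zero h22)
      (twist_off 𝒟 hσ (by simp) fsf_inl_zero fsf_inl_one h01) (twist_off 𝒟 hσ (by simp) fsf_inr_zero fsf_inl_zero h20)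
      (twist_off 𝒟 hσ (by simp) fsf_inr_zero fsf_inl_one h21))

/-- **TOP corner ⇒ cubic scalar.**  For an irreducible datum twisted by `z` and `u ≠ 0` with `⁅E₀₁, u⁆ = ⁅E₀₂, u⁆ = ⁅E₁₂, u⁆ = 0`,
`⁅E_ii, u⁆ = μ_i u`: `C₃ = P(μ₀ + z + 1, μ₁ + z, μ₂ + z − 1)·1` on the twisted module. [cite: Iachello2015, (7.24)] [cite: KnappVogan1995, Prop. 4.120] -/
theorem hasCubicScalar_of_isTwistOf_top [LieModule.IsIrreducible ℂ (Matrix (Fin 3) (Fin 3) ℂ) 𝒟.V] (hσ : IsTwistOf 𝒟.ρ z σ)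
    {u : 𝒟.V} (hu : u ≠ 0) {μ₀ μ₁ μ₂ : ℂ}
    (h00 : ⁅E 0 0, u⁆ = μ₀ • u) (h11 : ⁅E 1 1, u⁆ = μ₁ • u) (h22 : ⁅E 2 2, u⁆ = μ₂ • u)
    (h01 : ⁅E 0 1, u⁆ = 0) (h02 : ⁅E 0 2, u⁆ = 0) (h12 : ⁅E 1 2, u⁆ = 0) :
    HasCubicScalar σ
      ((μ₀ + z + 1) ^ 3 + (μ₁ + z) ^ 3 + (μ₂ + z - 1) ^ 3
        + ((μ₀ + z + 1) ^ 2 + (μ₁ + z) ^ 2 + (μ₂ + z - 1) ^ 2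
            - (μ₀ + z + 1) * (μ₁ + z) - (μ₁ + z) * (μ₂ + z - 1) - (μ₂ + z - 1) * (μ₀ + z + 1))
        - 2 * ((μ₀ + z + 1) + (μ₁ + z) + (μ₂ + z - 1)) - 3) :=
  hasCubicScalar_of_eigenvector (submodule_eq_bot_or_top_of_isTwistOf 𝒟 hσ) hu
    (upqCubicOp_apply_of_extreme_top σ
      (twist_diag 𝒟 hσ fsf_inl_zero h00) (twist_diag 𝒟 hσ fsf_inl_one h11) (twist_diag 𝒟 hσ fsf_inr_zero h22)
      (twist_off 𝒟 hσ (by simp) fsf_inl_zero fsf_inl_one h01) (twist_off 𝒟 hσ (by simp) fsf_inl_zero fsf_inr_zero h02)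
      (twist_off 𝒟 hσ (by simp) fsf_inl_one fsf_inr_zero h12))

/-! ### The corner vectors of Kovačević's basis -/

/-- `E₀₀ u¹_{n,m} = ((3n + m − 3)∕6) u¹_{n,m}` (`E₀₀ = ⅔H_α + ⅓H_β`, ★ `ρfun_E`, ★ `Ha_vec`, ★ `Hb_vec`). [cite: Kovacevic2021, §3 Def 1] -/
theorem lie_E00_vec_one (n m : ℤ) : ⁅E 0 0, 𝒟.vec n m 1⁆ = ((3 * (n : ℂ) + m - 3) / 6) • 𝒟.vec n m 1 := by
  rw [lie_def, ρfun_E]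
  simp only [LinearMap.add_apply, LinearMap.smul_apply, Ha_vec, Hb_vec, smul_smul, ← add_smul]
  congr 1
  push_cast
  ring

/-- `E₁₁ u¹_{n,m} = ((m − 3n + 3)∕6) u¹_{n,m}` (`E₁₁ = −⅓H_α + ⅓H_β`). [cite: Kovacevic2021, §3 Def 1] -/
theorem lie_E11_vec_one (n m : ℤ) : ⁅E 1 1, 𝒟.vec n m 1⁆ = (((m : ℂ) - 3 * n + 3) / 6) • 𝒟.vec n m 1 := by
  rw [lie_def, ρfun_E]
  simp only [LinearMap.add_apply, LinearMap.smul_apply, Ha_vec, Hb_vec, smul_smul, ← add_smul]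
  congr 1
  push_cast
  ring

/-- `E₂₂ u¹_{n,m} = (−m∕3) u¹_{n,m}` (`E₂₂ = −⅓H_α − ⅔H_β`). [cite: Kovacevic2021, §3 Def 1] -/
theorem lie_E22_vec_one (n m : ℤ) : ⁅E 2 2, 𝒟.vec n m 1⁆ = (-(m : ℂ) / 3) • 𝒟.vec n m 1 := by
  rw [lie_def, ρfun_E]
  simp only [LinearMap.add_apply, LinearMap.smul_apply, Ha_vec, Hb_vec, smul_smul, ← add_smul]
  congr 1
  push_cast
  ring

/-- At a `K`-type with no `K`-type at `(n ± 1, m − 3)` the corner vector `u¹_{n,m}` is killed by `𝔭⁻ = ⟨E₂₀, E₂₁⟩`: `E₂₀ u¹_{n,m} = 0`.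
[cite: Kovacevic2021, §3 Thm 1] -/
theorem lie_E20_vec_one_of_not_mem {n m : ℤ} (hE : (n + 1, m - 3) ∉ 𝒟.S) (hW : (n - 1, m - 3) ∉ 𝒟.S) : ⁅E 2 0, 𝒟.vec n m 1⁆ = 0 := by
  rw [lie_E20_vec n m le_rfl, vec_of_not_mem _ hE, vec_of_not_mem _ hW, smul_zero, smul_zero, add_zero]

/-- Same corner: `E₂₁ u¹_{n,m} = 0`. [cite: Kovacevic2021, §3 Thm 1] -/
theorem lie_E21_vec_one_of_not_mem {n m : ℤ} (hE : (n + 1, m - 3) ∉ 𝒟.S) (hW : (n - 1, m - 3) ∉ 𝒟.S) : ⁅E 2 1, 𝒟.vec n m 1⁆ = 0 := by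
  rw [lie_E21_vec n m 1, vec_of_not_mem _ hE, vec_of_not_mem _ hW, smul_zero, smul_zero, add_zero]

/-- At a `K`-type with no `K`-type at `(n ± 1, m + 3)` the corner vector `u¹_{n,m}` is killed by `𝔭⁺ = ⟨E₀₂, E₁₂⟩`: `E₀₂ u¹_{n,m} = 0`.
[cite: Kovacevic2021, §3 Thm 1] -/
theorem lie_E02_vec_one_of_not_mem {n m : ℤ} (hE : (n + 1, m + 3) ∉ 𝒟.S) (hW : (n - 1, m + 3) ∉ 𝒟.S) : ⁅E 0 2, 𝒟.vec n m 1⁆ = 0 := by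
  rw [lie_E02_vec n m 1, vec_of_not_mem _ hE, vec_of_not_mem _ hW, smul_zero, smul_zero, add_zero]

/-- Same corner: `E₁₂ u¹_{n,m} = 0`. [cite: Kovacevic2021, §3 Thm 1] -/
theorem lie_E12_vec_one_of_not_mem {n m : ℤ} (hE : (n + 1, m + 3) ∉ 𝒟.S) (hW : (n - 1, m + 3) ∉ 𝒟.S) : ⁅E 1 2, 𝒟.vec n m 1⁆ = 0 := by
  rw [lie_E12_vec n m le_rfl, vec_of_not_mem _ hE, vec_of_not_mem _ hW, smul_zero, smul_zero, add_zero]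

/-- **CUBIC SCALAR FROM A BOTTOM CORNER `K`-TYPE.**  For an irreducible datum twisted by `z` (★ `IsTwistOf`) and a `K`-type `(n, m) ∈ S` with no
`K`-type at `(n ± 1, m − 3)`, the twisted module has `C₃ = P(x, y, w)·1` with `x = 1 − m∕3 + z`, `y = (3n + m − 3)∕6 + z`, `w = (m − 3n − 3)∕6 + z`
(the Harish-Chandra parameter of the corner vector `u¹_{n,m}` for the Borel `⟨E₀₁, E₂₀, E₂₁⟩`, shifted by the twist).
[cite: Iachello2015, (7.24)] [cite: Kovacevic2021, §3 Def 1, Thm 1] [cite: KnappVogan1995, Prop. 4.120] -/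
theorem hasCubicScalar_of_isTwistOf_vec_bottom [LieModule.IsIrreducible ℂ (Matrix (Fin 3) (Fin 3) ℂ) 𝒟.V] (hσ : IsTwistOf 𝒟.ρ z σ)
    {n m : ℤ} (hS : (n, m) ∈ 𝒟.S) (hE : (n + 1, m - 3) ∉ 𝒟.S) (hW : (n - 1, m - 3) ∉ 𝒟.S) :
    HasCubicScalar σ
      ((1 - (m : ℂ) / 3 + z) ^ 3 + ((3 * (n : ℂ) + m - 3) / 6 + z) ^ 3 + (((m : ℂ) - 3 * n - 3) / 6 + z) ^ 3
        + ((1 - (m : ℂ) / 3 + z) ^ 2 + ((3 * (n : ℂ) + m - 3) / 6 + z) ^ 2 + (((m : ℂ) - 3 * n - 3) / 6 + z) ^ 2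
            - (1 - (m : ℂ) / 3 + z) * ((3 * (n : ℂ) + m - 3) / 6 + z)
            - ((3 * (n : ℂ) + m - 3) / 6 + z) * (((m : ℂ) - 3 * n - 3) / 6 + z)
            - (((m : ℂ) - 3 * n - 3) / 6 + z) * (1 - (m : ℂ) / 3 + z))
        - 2 * ((1 - (m : ℂ) / 3 + z) + ((3 * (n : ℂ) + m - 3) / 6 + z) + (((m : ℂ) - 3 * n - 3) / 6 + z)) - 3) :=
  (hasCubicScalar_of_isTwistOf_bottom 𝒟 hσ (𝒟.vec_ne_zero ⟨hS, le_rfl, 𝒟.one_le_of_mem hS⟩)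
    (lie_E00_vec_one 𝒟 n m) (lie_E11_vec_one 𝒟 n m) (lie_E22_vec_one 𝒟 n m) (lie_E01_vec_one n m)
    (lie_E20_vec_one_of_not_mem 𝒟 hE hW) (lie_E21_vec_one_of_not_mem 𝒟 hE hW)).of_eq (by ring)

/-- **CUBIC SCALAR FROM A TOP CORNER `K`-TYPE.**  For an irreducible datum twisted by `z` and a `K`-type `(n, m) ∈ S` with no `K`-type at
`(n ± 1, m + 3)`, the twisted module has `C₃ = P(x, y, w)·1` with `x = (3n + m + 3)∕6 + z`, `y = (m − 3n + 3)∕6 + z`, `w = −m∕3 − 1 + z`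
(the Harish-Chandra parameter of `u¹_{n,m}` for the Borel `⟨E₀₁, E₀₂, E₁₂⟩`, shifted by the twist).
[cite: Iachello2015, (7.24)] [cite: Kovacevic2021, §3 Def 1, Thm 1] [cite: KnappVogan1995, Prop. 4.120] -/
theorem hasCubicScalar_of_isTwistOf_vec_top [LieModule.IsIrreducible ℂ (Matrix (Fin 3) (Fin 3) ℂ) 𝒟.V] (hσ : IsTwistOf 𝒟.ρ z σ)
    {n m : ℤ} (hS : (n, m) ∈ 𝒟.S) (hE : (n + 1, m + 3) ∉ 𝒟.S) (hW : (n - 1, m + 3) ∉ 𝒟.S) :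
    HasCubicScalar σ
      ((((3 * (n : ℂ) + m + 3) / 6 + z)) ^ 3 + (((m : ℂ) - 3 * n + 3) / 6 + z) ^ 3 + (-(m : ℂ) / 3 - 1 + z) ^ 3
        + (((3 * (n : ℂ) + m + 3) / 6 + z) ^ 2 + (((m : ℂ) - 3 * n + 3) / 6 + z) ^ 2 + (-(m : ℂ) / 3 - 1 + z) ^ 2
            - ((3 * (n : ℂ) + m + 3) / 6 + z) * (((m : ℂ) - 3 * n + 3) / 6 + z)
            - (((m : ℂ) - 3 * n + 3) / 6 + z) * (-(m : ℂ) / 3 - 1 + z)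
            - (-(m : ℂ) / 3 - 1 + z) * ((3 * (n : ℂ) + m + 3) / 6 + z))
        - 2 * (((3 * (n : ℂ) + m + 3) / 6 + z) + (((m : ℂ) - 3 * n + 3) / 6 + z) + (-(m : ℂ) / 3 - 1 + z)) - 3) :=
  (hasCubicScalar_of_isTwistOf_top 𝒟 hσ (𝒟.vec_ne_zero ⟨hS, le_rfl, 𝒟.one_le_of_mem hS⟩)
    (lie_E00_vec_one 𝒟 n m) (lie_E11_vec_one 𝒟 n m) (lie_E22_vec_one 𝒟 n m) (lie_E01_vec_one n m)
    (lie_E02_vec_one_of_not_mem 𝒟 hE hW) (lie_E12_vec_one_of_not_mem 𝒟 hE hW)).of_eq (by ring)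

/-- **INTEGER FORM (the shape the calibration consumes).**  If the three arguments of `P` at a bottom corner are the integers `a, b, c`
(i.e. `{1 − m∕3 + z, (3n+m−3)∕6 + z, (m−3n−3)∕6 + z} = (a, b, c)` in this order), the cubic scalar is ★ `cubicOf a b c`; permute with
★ `cubicOf_swap₁₂` ∕ `cubicOf_swap₂₃` as needed. [cite: Iachello2015, (7.24)] -/
theorem hasCubicScalar_cubicOf_of_isTwistOf_vec_bottom [LieModule.IsIrreducible ℂ (Matrix (Fin 3) (Fin 3) ℂ) 𝒟.V]
    (hσ : IsTwistOf 𝒟.ρ z σ) {n m : ℤ} (hS : (n, m) ∈ 𝒟.S) (hE : (n + 1, m - 3) ∉ 𝒟.S) (hW : (n - 1, m - 3) ∉ 𝒟.S)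
    (a b c : ℤ) (ha : 1 - (m : ℂ) / 3 + z = a) (hb : (3 * (n : ℂ) + m - 3) / 6 + z = b) (hc : ((m : ℂ) - 3 * n - 3) / 6 + z = c) :
    HasCubicScalar σ ((cubicOf a b c : ℤ) : ℂ) := by
  refine (hasCubicScalar_of_isTwistOf_vec_bottom 𝒟 hσ hS hE hW).of_eq ?_
  rw [ha, hb, hc, cubicOf_cast]

/-- **INTEGER FORM, top corner.** [cite: Iachello2015, (7.24)] -/
theorem hasCubicScalar_cubicOf_of_isTwistOf_vec_top [LieModule.IsIrreducible ℂ (Matrix (Fin 3) (Fin 3) ℂ) 𝒟.V]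
    (hσ : IsTwistOf 𝒟.ρ z σ) {n m : ℤ} (hS : (n, m) ∈ 𝒟.S) (hE : (n + 1, m + 3) ∉ 𝒟.S) (hW : (n - 1, m + 3) ∉ 𝒟.S)
    (a b c : ℤ) (ha : (3 * (n : ℂ) + m + 3) / 6 + z = a) (hb : ((m : ℂ) - 3 * n + 3) / 6 + z = b) (hc : -(m : ℂ) / 3 - 1 + z = c) :
    HasCubicScalar σ ((cubicOf a b c : ℤ) : ℂ) := by
  refine (hasCubicScalar_of_isTwistOf_vec_top 𝒟 hσ hS hE hW).of_eq ?_
  rw [ha, hb, hc, cubicOf_cast]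

end Engine

end Summit.HodgeConjecture.HodgeConjecture.Cruxes.H413.K2E1bGKCohomologyU21

end
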